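import Summits.QuantumFields.BalabanUV.Beta.EriceRemainderEnclosureHistoryAutonomyComparisonNonlinearRowDefect
import Summits.QuantumFields.BalabanUV.Beta.EriceRemainderEnclosureHistoryAutonomyComparisonNonlinearLight

/-!
# EriceRemainderEnclosureHistoryAutonomyComparisonNonlinearGaugeDefect — (E121d) THE GENERIC STEP OF THE LEVEL-GAUGE ROW INDUCTION: a PRICED per-age damping defect in,
# the gauge WITH THE EXCESS DIFFERENCE out.  Base `B u = β₀ + Σ_{k<K} L_k·u_k` (`β₀ > 0`, `L ≥ 0`, `L_0 = 0`; profile, range, sizes ARBITRARY); `B′ ≥ B` with an ISOTONE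
# excess and a modulus (for its family); base orbit `h = S y`, `X_m = B′(S′h_m) − B(S h_m)`, `e_m = (B′ − B)(S′h_m)`, `G_m = X_m·h_m²` (the gauge quantity).  **`gauge_step_of_defect`**:
# if `X_m ≥ 0` and `G_{m+1} ≤ G_m` for `m ≥ n+1`, configuration `n+1`'s defect obeys `δ_{k−1} − δ_k ≤ θ_k·δ_{k−1}` with `0 ≤ θ_k ≤ F(n+k+1) + ξ_k`, and the extra `ξ_k` is
# PRICED — `c_{n+1,k}·ξ_k·W ≤ (1∕20)·L_kh_{n+1+k}h_{n+1}²X_{n+1}` for every window `0 ≤ W ≤ X_{n+1}h_{n+1}²Σ_{1≤l<k}a_{n+1+l}` — then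
#
#   **`G_{n+1} + (e_n − e_{n+1})·h_n² ≤ G_n`**.
#
# The proof is (E119d) `gauge_step_mod`'s ((E121c) `row_ge_of_defect`, windows by (E119d) `conf_window_le_mod`, per age (E119a) `flow_damped_age_ge_two_le_slack` — cost
# `≤ (19∕20)·share` — plus the priced extra `≤ (1∕20)·share`, (E116c) `flow_age_one_le`, budget (E116b) `flow_budget_le`), except that the excess difference `e_n − e_{n+1} ≥ 0`
# of the row inequality is KEPT instead of dropped.  Consequence (sequel (E121e)): along the induction `G_m ≥ Σ_{j<J} h_{m+j}²·Δe_{m+j}` for every `J` — the VARIATION BOUND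
# that (E121a) `conf_incr_ge_var` consumes; instances of the pricing: `ξ = 0` ((E118e), (E120c)), `ξ = ME·h³∕2` ((E119b) `defect_mod_le`), `ξ = e·h²` ((E121b) `defect_size_le`).

Cell `pub-balaban`, β-function sub-cell, BINDER row D4 «RemainderConst leaves for Bałaban's split» (`HOME/BINDER-OWNERS.md`; owner lineage `b2b-balaban-beta-an4`;
this file by co-owner #2 lineage `b2b-balaban-beta-d4-p2`, generation 99), β-FLOW TEAM duty (1), FREEZE (0) honoured (def-free; imports (E121c) `…NonlinearRowDefect`,
(E120c) `…NonlinearLight`; uses (E118a) `affine_facts`, (E119b) `excess_facts` ∕ `cmp_of_steps_nonneg`, (E119d) `conf_window_le_mod`, (E119a)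
`flow_damped_age_ge_two_le_slack`, (E116c) `flow_age_one_le`, (E116b) `flow_budget_le`, (E48a) `family_mem` ∕ `family_zero` BY NAME; the proof is (E119d)
`gauge_step_mod`'s re-run — nothing else restated).

HONEST FRAMING (page 1, verbatim and binding).  *"Discharging BetaPertH makes Bałaban's UV stability UNCONDITIONAL — a real constructive-QFT result; it is
NOT the continuum limit and NOT the Clay problem."*  THIS FILE DISCHARGES NOTHING OF THE KIND.  Elementary real analysis about ABSTRACT functionals on a box
]0,γ]^ℕ with displayed floors, moduli, profiles and signs — hypotheses of a census, not facts; the form, signs, ages and moments of Bałaban's (1.22) limit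
functional are NOT PRINTED ([I] p. 298; GAPS G-t4-U2-1∕-2) and NOT asserted.  Row D4 class UNCHANGED (critical-path width 0; instance 0∕1; D4 DISCHARGE NO
DATE).  HONEST DEPENDENCY: continuum YM on T⁴ ⇐ BetaPertH ∧ nine spine estimates (0/9 proved); BetaPertH ⇐ (D1) ∧ (D4) ∧ CAP+tail; G-an2-4 gates asym, D1
and NE2/3/4.  NOT CLAIMED here: any comparison theorem (that is the sequel); anything printed — NOT B12 Thm 2, NOT BetaPertH, NOT continuum, NOT Clay.

WHAT IS PROVED ([folklore]; 0 `def`, 0 sorry).  **`gauge_step_of_defect`**.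
-/

noncomputable section
open Finset Set

namespace Summit.QuantumFields.BalabanUV.Beta.EriceRemainderEnclosureHistoryAutonomyComparisonNonlinearGaugeDefect

open Literature.MathematicalPhysics.QuantumFieldTheory.Balaban1983to89
open Literature.MathematicalPhysics.QuantumFieldTheory.Balaban1983to89.T4BetaStationary
open Literature.MathematicalPhysics.QuantumFieldTheory.Balaban1983to89.T4BetaFlowWellPosed
open Summit.QuantumFields.BalabanUV.Beta.EriceRemainderEnclosureHistoryAutonomyOrder (family_mem family_zero)
open Summit.QuantumFields.BalabanUV.Beta.EriceRemainderEnclosureHistoryAutonomyComparisonAgeCompositionHeatingCriterionFlow (flow_budget_le)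
open Summit.QuantumFields.BalabanUV.Beta.EriceRemainderEnclosureHistoryAutonomyComparisonAgeCompositionLevelGaugePrep (flow_age_one_le)
open Summit.QuantumFields.BalabanUV.Beta.EriceRemainderEnclosureHistoryAutonomyComparisonNonlinearRowPrep (affine_facts)
open Summit.QuantumFields.BalabanUV.Beta.EriceRemainderEnclosureHistoryAutonomyComparisonNonlinearRowDefect (row_ge_of_defect)
open Summit.QuantumFields.BalabanUV.Beta.EriceRemainderEnclosureHistoryAutonomyComparisonNonlinearSlack (flow_damped_age_ge_two_le_slack)
open Summit.QuantumFields.BalabanUV.Beta.EriceRemainderEnclosureHistoryAutonomyComparisonNonlinearModulusPrep (excess_facts cmp_of_steps_nonneg)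
open Summit.QuantumFields.BalabanUV.Beta.EriceRemainderEnclosureHistoryAutonomyComparisonNonlinearModulus (conf_window_le_mod)

variable {B B' : (ℕ → ℝ) → ℝ} {γ β₀ M' : ℝ} {L : ℕ → ℝ} {K : ℕ} {S S' : ℝ → ℕ → ℝ}

/-! ## §1 The generic gauge step -/

set_option maxHeartbeats 800000 in
/-- **THE STEP OF THE ROW INDUCTION WITH A PRICED DEFECT, KEEPING THE EXCESS DIFFERENCE.**  Base affine (`L_0 = 0`), `B′ ≥ B` with isotone excess and a modulus; base
orbit `h = S y`.  Suppose `X_m ≥ 0` and `X_{m+1}h_{m+1}² ≤ X_mh_m²` for all `m ≥ n+1`; suppose configuration `n+1`'s damping defect is controlled age by age,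
`δ^{(n+1)}_{k−1} − δ^{(n+1)}_k ≤ θ_k·δ^{(n+1)}_{k−1}` with `0 ≤ θ_k ≤ F(n+k+1) + ξ_k`, `ξ_k ≥ 0`, where the EXTRA `ξ_k` IS PRICED BY THE SPARE TWENTIETH: for every window
`0 ≤ S ≤ X_{n+1}h_{n+1}²Σ_{1≤l<k} a_{n+1+l}`, `c_{n+1,k}·ξ_k·S ≤ (1∕20)·L_kh_{n+1+k}h_{n+1}²X_{n+1}` (`k ≥ 2`).  Then
**`X_{n+1}·h_{n+1}² + (e_n − e_{n+1})·h_n² ≤ X_n·h_n²`** — the level gauge WITH the excess difference of the row kept ((E121c) `row_ge_of_defect` + (E119d)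
`conf_window_le_mod` + (E119a) `flow_damped_age_ge_two_le_slack` + the pricing hypothesis + (E116c) `flow_age_one_le` + (E116b) `flow_budget_le`).  Instances of the
pricing: `ξ = 0` (constant excess, light rows), `ξ_k = ME·h³∕2` ((E119b) `defect_mod_le`), `ξ_k = e·h²` ((E121b) `defect_size_le`). [folklore] -/
theorem gauge_step_of_defect (hBaff : ∀ u, SeqBox γ u → B u = β₀ + ∑ k ∈ range K, L k * u k) (hL : ∀ k, 0 ≤ L k) (hβ : 0 < β₀)
    (hB' : ∀ u u' : ℕ → ℝ, SeqBox γ u → SeqBox γ u' → ∀ D : ℝ, (∀ j, |u j - u' j| ≤ D) → |B' u - B' u'| ≤ M' * D) (hM' : 0 ≤ M')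
    (hexc : ∀ u, SeqBox γ u → B u ≤ B' u)
    (hDmono : ∀ u v : ℕ → ℝ, SeqBox γ u → SeqBox γ v → (∀ j, u j ≤ v j) → B' u - B u ≤ B' v - B v)
    (hS : ∀ p, 0 < p → p ≤ γ → SeqBox γ (S p) ∧ MemFlow B p (S p))
    (huniq : ∀ p, 0 < p → p ≤ γ → ∀ u u' : ℕ → ℝ, SeqBox γ u → SeqBox γ u' → MemFlow B p u → MemFlow B p u' → u = u')
    (hS' : ∀ p, 0 < p → p ≤ γ → SeqBox γ (S' p) ∧ MemFlow B' p (S' p))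
    (huniq' : ∀ p, 0 < p → p ≤ γ → ∀ u u' : ℕ → ℝ, SeqBox γ u → SeqBox γ u' → MemFlow B' p u → MemFlow B' p u' → u = u')
    {y : ℝ} (hy : 0 < y) (hyγ : y ≤ γ) (n : ℕ) (hX : ∀ m, n + 1 ≤ m → 0 ≤ B' (S' (S y m)) - B (S (S y m)))
    (hg : ∀ m, n + 1 ≤ m → (B' (S' (S y (m + 1))) - B (S (S y (m + 1)))) * S y (m + 1) ^ 2 ≤ (B' (S' (S y m)) - B (S (S y m))) * S y m ^ 2)
    {θ ξ : ℕ → ℝ} (hθ0 : ∀ k, 0 ≤ θ k)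
    (hdef : ∀ j, j + 1 < K → (1 / S' (S y (n + 1)) j ^ 2 - 1 / S y (n + 1 + j) ^ 2) - (1 / S' (S y (n + 1)) (j + 1) ^ 2 - 1 / S y (n + 1 + j + 1) ^ 2)
      ≤ θ (j + 1) * (1 / S' (S y (n + 1)) j ^ 2 - 1 / S y (n + 1 + j) ^ 2))
    (hθle : ∀ k, 2 ≤ k → k < K → θ k ≤ ∑ q ∈ Ico 1 K, L q * S y (n + k + 1 + q) ^ 3 / 2 + ξ k)
    (hprice : ∀ k, 2 ≤ k → k < K → ∀ W : ℝ, 0 ≤ W →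
      W ≤ (B' (S' (S y (n + 1))) - B (S (S y (n + 1)))) * S y (n + 1) ^ 2 * ∑ l ∈ Ico 1 k, 1 / S y (n + 1 + l) ^ 2 →
      L k * S y (n + 1 + k) ^ 3 / 2 * ξ k * W ≤ 1 / 20 * (L k * S y (n + 1 + k) * S y (n + 1) ^ 2 * (B' (S' (S y (n + 1))) - B (S (S y (n + 1)))))) :
    (B' (S' (S y (n + 1))) - B (S (S y (n + 1)))) * S y (n + 1) ^ 2
        + ((B' (S' (S y n)) - B (S' (S y n))) - (B' (S' (S y (n + 1))) - B (S' (S y (n + 1))))) * S y n ^ 2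
      ≤ (B' (S' (S y n)) - B (S (S y n))) * S y n ^ 2 := by
  obtain ⟨hmono', hlo'⟩ := excess_facts hBaff hL hβ hexc hDmono
  obtain ⟨hmono, hlo, hdom, _⟩ := affine_facts hBaff hL hβ
  have hh := (hS y hy hyγ).1
  have hf := (hS y hy hyγ).2
  have hpos : ∀ j, 0 < S y j := fun j => (hh j).1
  have hcmp := cmp_of_steps_nonneg hBaff hL hβ hB' hM' hexc hDmono hS huniq hS' huniq' hy hyγ n hX
  set X1 : ℝ := B' (S' (S y (n + 1))) - B (S (S y (n + 1))) with hX1def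
  have hX10 : 0 ≤ X1 := hX (n + 1) le_rfl
  have hrow := row_ge_of_defect hBaff hL hβ hmono' hβ hB' hM' hlo' hS huniq hS' huniq' hy hyγ n hcmp hθ0 hdef
  have hq1 := family_mem hS hy hyγ (n + 1)
  have hwin := conf_window_le_mod hBaff hL hβ hB' hM' hexc hDmono hS huniq hS' huniq' hy hyγ n (hcmp (n + 1) (by omega)) hg
  -- per-age costs
  have hcost : ∑ k ∈ Ico 1 K, L k * S y (n + k) ^ 3 / 2 * X1
      + ∑ k ∈ Ico 1 K, (L k * S y (n + k) ^ 3 / 2 - L k * S y (n + 1 + k) ^ 3 / 2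
          + L k * S y (n + 1 + k) ^ 3 / 2 * θ k)
          * (1 / S' (S y (n + 1)) (k - 1) ^ 2 - 1 / S y (n + k) ^ 2)
      ≤ (∑ k ∈ Ico 1 K, L k * S y (n + 1 + k)) * S y (n + 1) ^ 2 * X1 := by
    rw [← sum_add_distrib, sum_mul, sum_mul]
    refine sum_le_sum fun k hk => ?_
    have hk1 : 1 ≤ k := (mem_Ico.mp hk).1
    by_cases hk2 : 2 ≤ k
    · obtain ⟨j, rfl⟩ : ∃ j, k = j + 1 := ⟨k - 1, by omega⟩
      simp only [Nat.add_sub_cancel]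
      have hS0 : 0 ≤ 1 / S' (S y (n + 1)) j ^ 2 - 1 / S y (n + (j + 1)) ^ 2 := by
        have hc := hcmp (n + 1) (by omega) j; rw [show n + 1 + j = n + (j + 1) by ring] at hc
        have hwp := ((hS' _ hq1.1 hq1.2).1 j).1
        exact sub_nonneg.mpr (one_div_le_one_div_of_le (pow_pos hwp 2) (pow_le_pow_left₀ hwp.le hc 2))
      have hSw : 1 / S' (S y (n + 1)) j ^ 2 - 1 / S y (n + (j + 1)) ^ 2 ≤ X1 * S y (n + 1) ^ 2 * ∑ l ∈ Ico 1 (j + 1), 1 / S y (n + 1 + l) ^ 2 := by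
        have := hwin j; rwa [show n + 1 + j = n + (j + 1) by ring] at this
      have hF0 : 0 ≤ ∑ q ∈ Ico 1 K, L q * S y (n + (j + 1) + 1 + q) ^ 3 / 2 :=
        sum_nonneg fun q _ => by have := hL q; have := hpos (n + (j + 1) + 1 + q); positivity
      have hmain := flow_damped_age_ge_two_le_slack hmono hL hβ hlo hdom hh hf n hk2 hX10 hS0 hSw hF0 le_rfl
      have hSw' : 1 / S' (S y (n + 1)) j ^ 2 - 1 / S y (n + (j + 1)) ^ 2 ≤ X1 * S y (n + 1) ^ 2 * ∑ l ∈ Ico 1 (j + 1), 1 / S y (n + 1 + l) ^ 2 := hSw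
      have hextra := hprice (j + 1) hk2 (mem_Ico.mp hk).2 _ hS0 hSw'
      have hθk := hθle (j + 1) hk2 (mem_Ico.mp hk).2
      rw [show n + (j + 1) + 1 = n + (j + 1) + 1 from rfl] at hθk
      -- the defect coefficient: c'·θ·S ≤ c'·F·S + c'·ξ·S
      have hc'0 : 0 ≤ L (j + 1) * S y (n + 1 + (j + 1)) ^ 3 / 2 := by have := hL (j + 1); have := hpos (n + 1 + (j + 1)); positivity
      have hsplit : L (j + 1) * S y (n + 1 + (j + 1)) ^ 3 / 2 * θ (j + 1) * (1 / S' (S y (n + 1)) j ^ 2 - 1 / S y (n + (j + 1)) ^ 2)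
          ≤ L (j + 1) * S y (n + 1 + (j + 1)) ^ 3 / 2 * (∑ q ∈ Ico 1 K, L q * S y (n + (j + 1) + 1 + q) ^ 3 / 2) * (1 / S' (S y (n + 1)) j ^ 2 - 1 / S y (n + (j + 1)) ^ 2)
            + L (j + 1) * S y (n + 1 + (j + 1)) ^ 3 / 2 * ξ (j + 1) * (1 / S' (S y (n + 1)) j ^ 2 - 1 / S y (n + (j + 1)) ^ 2) := by
        have := mul_le_mul_of_nonneg_right (mul_le_mul_of_nonneg_left hθk hc'0) hS0
        have e : L (j + 1) * S y (n + 1 + (j + 1)) ^ 3 / 2 * (∑ q ∈ Ico 1 K, L q * S y (n + (j + 1) + 1 + q) ^ 3 / 2 + ξ (j + 1))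
            * (1 / S' (S y (n + 1)) j ^ 2 - 1 / S y (n + (j + 1)) ^ 2)
            = L (j + 1) * S y (n + 1 + (j + 1)) ^ 3 / 2 * (∑ q ∈ Ico 1 K, L q * S y (n + (j + 1) + 1 + q) ^ 3 / 2) * (1 / S' (S y (n + 1)) j ^ 2 - 1 / S y (n + (j + 1)) ^ 2)
              + L (j + 1) * S y (n + 1 + (j + 1)) ^ 3 / 2 * ξ (j + 1) * (1 / S' (S y (n + 1)) j ^ 2 - 1 / S y (n + (j + 1)) ^ 2) := by ring
        rw [e] at this; exact this
      have e1 : (L (j + 1) * S y (n + (j + 1)) ^ 3 / 2 - L (j + 1) * S y (n + 1 + (j + 1)) ^ 3 / 2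
            + L (j + 1) * S y (n + 1 + (j + 1)) ^ 3 / 2 * θ (j + 1))
            * (1 / S' (S y (n + 1)) j ^ 2 - 1 / S y (n + (j + 1)) ^ 2)
          = (L (j + 1) * S y (n + (j + 1)) ^ 3 / 2 - L (j + 1) * S y (n + 1 + (j + 1)) ^ 3 / 2)
              * (1 / S' (S y (n + 1)) j ^ 2 - 1 / S y (n + (j + 1)) ^ 2)
            + L (j + 1) * S y (n + 1 + (j + 1)) ^ 3 / 2 * θ (j + 1) * (1 / S' (S y (n + 1)) j ^ 2 - 1 / S y (n + (j + 1)) ^ 2) := by ring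
      rw [e1]
      have e2 : L (j + 1) * S y (n + (j + 1)) ^ 3 / 2 * X1
            + (L (j + 1) * S y (n + (j + 1)) ^ 3 / 2 - L (j + 1) * S y (n + 1 + (j + 1)) ^ 3 / 2
              + L (j + 1) * S y (n + 1 + (j + 1)) ^ 3 / 2 * (∑ q ∈ Ico 1 K, L q * S y (n + (j + 1) + 1 + q) ^ 3 / 2))
              * (1 / S' (S y (n + 1)) j ^ 2 - 1 / S y (n + (j + 1)) ^ 2)
          = L (j + 1) * S y (n + (j + 1)) ^ 3 / 2 * X1
            + (L (j + 1) * S y (n + (j + 1)) ^ 3 / 2 - L (j + 1) * S y (n + 1 + (j + 1)) ^ 3 / 2)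
              * (1 / S' (S y (n + 1)) j ^ 2 - 1 / S y (n + (j + 1)) ^ 2)
            + L (j + 1) * S y (n + 1 + (j + 1)) ^ 3 / 2 * (∑ q ∈ Ico 1 K, L q * S y (n + (j + 1) + 1 + q) ^ 3 / 2)
              * (1 / S' (S y (n + 1)) j ^ 2 - 1 / S y (n + (j + 1)) ^ 2) := by ring
      rw [e2] at hmain
      linarith
    · have hk1' : k = 1 := by omega
      subst hk1'
      have hzero : 1 / S' (S y (n + 1)) (1 - 1) ^ 2 - 1 / S y (n + 1) ^ 2 = 0 := by
        rw [show (1 : ℕ) - 1 = 0 from rfl, family_zero hS' hq1.1 hq1.2]; ring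
      rw [hzero, mul_zero, add_zero]
      have := flow_age_one_le hmono hL hβ hlo hh hf n
      exact mul_le_mul_of_nonneg_right (by linarith) hX10
  -- the budget of the row
  have hbud : ∑ k ∈ Ico 1 K, L k * S y (n + 1 + k) ≤ 1 / S y (n + 1) ^ 2 - 1 / S y n ^ 2 := by
    refine le_trans ?_ (flow_budget_le hdom hh hf n)
    exact sum_le_sum_of_subset_of_nonneg (fun k hk => mem_range.mpr (mem_Ico.mp hk).2) fun k _ _ => mul_nonneg (hL k) (hpos _).le
  have hn2 : 0 < S y n ^ 2 := pow_pos (hpos n) 2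
  have hn12 : 0 < S y (n + 1) ^ 2 := pow_pos (hpos (n + 1)) 2
  have hstep : X1 * S y (n + 1) ^ 2 * (1 / S y n ^ 2)
      + ((B' (S' (S y n)) - B (S' (S y n))) - (B' (S' (S y (n + 1))) - B (S' (S y (n + 1))))) ≤ B' (S' (S y n)) - B (S (S y n)) := by
    have h1 : (∑ k ∈ Ico 1 K, L k * S y (n + 1 + k)) * S y (n + 1) ^ 2 * X1 ≤ (1 / S y (n + 1) ^ 2 - 1 / S y n ^ 2) * S y (n + 1) ^ 2 * X1 :=
      mul_le_mul_of_nonneg_right (mul_le_mul_of_nonneg_right hbud hn12.le) hX10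
    have e0 : (1 / S y (n + 1) ^ 2 - 1 / S y n ^ 2) * S y (n + 1) ^ 2 = 1 - S y (n + 1) ^ 2 * (1 / S y n ^ 2) := by
      rw [sub_mul, one_div_mul_cancel (ne_of_gt hn12), mul_comm]
    rw [e0] at h1
    have hF : (∑ k ∈ Ico 1 K, L k * S y (n + k) ^ 3 / 2) * X1 = ∑ k ∈ Ico 1 K, L k * S y (n + k) ^ 3 / 2 * X1 := by rw [sum_mul]
    nlinarith [hrow, hcost, h1, hF]
  have e2 : (X1 * S y (n + 1) ^ 2 * (1 / S y n ^ 2)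
      + ((B' (S' (S y n)) - B (S' (S y n))) - (B' (S' (S y (n + 1))) - B (S' (S y (n + 1)))))) * S y n ^ 2
      = X1 * S y (n + 1) ^ 2 + ((B' (S' (S y n)) - B (S' (S y n))) - (B' (S' (S y (n + 1))) - B (S' (S y (n + 1))))) * S y n ^ 2 := by
    rw [add_mul, mul_assoc, one_div_mul_cancel (ne_of_gt hn2), mul_one]
  have := mul_le_mul_of_nonneg_right hstep hn2.le
  rw [e2] at this
  exact this

end Summit.QuantumFields.BalabanUV.Beta.EriceRemainderEnclosureHistoryAutonomyComparisonNonlinearGaugeDefect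

end
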